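import Summits.ResolutionOfSingularities.ResolutionOfSingularities.Theorems.EquisingularLiftEquisingularLiftNatSectionsLiftPrincipal
import Summits.ResolutionOfSingularities.ResolutionOfSingularities.Theorems.EquisingularLiftEquisingularLiftNatF102FlatSectionsTorsionFree
import Summits.ResolutionOfSingularities.ResolutionOfSingularities.Theorems.EquisingularLiftEquisingularLiftNatF102CechH1UnitProjectiveLine
import Summits.ResolutionOfSingularities.ResolutionOfSingularities.Theorems.EquisingularLiftEquisingularLiftNatF102SectionLineBundle
import Literature.AlgebraicGeometry.Modules.SheafHomFrames
import Literature.AlgebraicGeometry.Modules.SheafHomLeft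
import Literature.AlgebraicGeometry.Modules.VectorBundleFiniteLocallyFree
import Literature.AlgebraicGeometry.Morphisms.FormalFunctionsModule
import Mathlib.RingTheory.DiscreteValuationRing.Basic
import HarnessLib

/-!
# [OURS · L1 W4.5(b) · LINE (T-j)-PROOF, BRICK B4 (d)] Lifting sections of `𝓗om(𝓘_{D₀}, 𝓘_{D₁})` from the closed fibre

Cell res-hironaka, LADDER-RESOLUTION rung L, slot W4.5(b), crux chain w45b: EL♮(3) = stmt-ResolutionOfSingularities-20148, residue
(T-j) = F-102 (LINE (T-j)-PROOF, res-L1-w45b-lead-2 g3; brick B4 `F102.exists_coordinate_functions` of res-L1-type-o6, sub-brick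
**(d)** dealt to lead-2 by res-L1-w45b-plan-1 22:23:29Z). `--supports stmt-ResolutionOfSingularities-20148 --as helper`. NOT a
statement of any manuscript; OURS; AI-written, weaker than expert review. No `sorry`; standard axioms; DEF-FREE.

THEOREM (`exists_unitSection_sheafHom_idealModule_eq`). `O` a discrete valuation ring, `θ : O ↠ k`, `f : C → Spec O` proper and flat
with `C` regular and integral, `(i, t)` cartesian over `Spec θ` with `Ck ≅ ℙ¹_{k'}`, `s₀, s₁` sections of `f`, and
`N := 𝓗om(𝓘_{D₀}, 𝓘_{D₁})` (`sheafHom (idealModule s₀) (idealModule s₁)`). ASSUME the special-fibre triviality (γ*):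
`i^*N ≅ 𝒪_{Ck}`. THEN every global section `σ` of `i^*N` is the pull-back `η(u)` of a global section `u` of `N` — in particular
`Hom(𝓘_{D₀}, 𝓘_{D₁}) = Γ(C, N) → Γ(C_k, i^*N) ∋ 1` is onto.

PROOF. Brick E (`P1VB.exists_unitSection_eq_of_ker_le_span`, p574087) on the cover of `C` by ALL affine opens (pairwise
intersections affine: `C` is separated over `Spec O`), with: kernel `ker θ = 𝔪_O = (ϖ)` for a uniformiser `ϖ`; `N` a vector bundle
(`𝓘_{D_j}` line bundles by res-L1-type-o6's (a3) `isVectorBundle_idealModule_of_section`, then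
`isFiniteLocallyFree_sheafHom'`); `ϖ`-torsion-freeness of its sections (res-D-pv-036's (G2) `smul_eq_zero_iff_of_flat_vectorBundle`, `C`
flat, `ϖ ≠ 0`); and `Ȟ¹(i⁻¹𝒰; i^*N) = 0` from (γ*) and `Ȟ¹` of `𝒪` on any affine cover of a projective line (res-D-pv-036's (G3)
`subsingleton_cechMH1_unit_of_iso_PP'`, transported along the iso by `subsingleton_cechMH1_of_iso`).
-/

noncomputable section

open CategoryTheory AlgebraicGeometry TopologicalSpace Opposite IsLocalRing
open Literature.AlgebraicGeometry Literature.AlgebraicGeometry.Morphisms Literature.AlgebraicGeometry.Modules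
open Literature.AlgebraicGeometry.Motives Literature.AlgebraicGeometry.Deformation

set_option linter.dupNamespace false -- mandated namespace `Summit.<Summit>.<Problem>` of this single-conjunct summit

namespace Summit.ResolutionOfSingularities.ResolutionOfSingularities.Cruxes.EquisingularLiftNat.F102

/-- **BRICK B4 (d) — sections of `𝓗om(𝓘_{D₀}, 𝓘_{D₁})` lift from the closed fibre**, assuming the special-fibre triviality
(γ*) `i^*𝓗om(𝓘_{D₀}, 𝓘_{D₁}) ≅ 𝒪_{Ck}`. [OURS] -/
theorem exists_unitSection_sheafHom_idealModule_eq (O : Type) [CommRing O] [IsDomain O] [IsDiscreteValuationRing O]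
    (k : Type) [Field k] (θ : O →+* k)
    (C : Scheme.{0}) (f : C ⟶ Spec (.of O)) [IsProper f] [Flat f]
    (Ck : Scheme.{0}) (i : Ck ⟶ C) (t : Ck ⟶ Spec (.of k)) [IsIntegral C]
    (hθ : Function.Surjective θ) (hreg : Resolution.Scheme.IsRegular C)
    (hsq : IsPullback i t f (Spec.map (CommRingCat.ofHom θ)))
    (k' : Type) [Field k'] (e : Ck ≅ ProjCech.PP k' 1)
    (s₀ s₁ : Spec (.of O) ⟶ C) (hs₀ : s₀ ≫ f = 𝟙 _) (hs₁ : s₁ ≫ f = 𝟙 _)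
    (hN : Nonempty ((Scheme.Modules.pullback i).obj (sheafHom (idealModule s₀) (idealModule s₁)) ≅ unitModule Ck))
    (σ : Γ((Scheme.Modules.pullback i).obj (sheafHom (idealModule s₀) (idealModule s₁)), i ⁻¹ᵁ ⊤)) :
    ∃ u : Γ(sheafHom (idealModule s₀) (idealModule s₁), ⊤),
      unitSection i (sheafHom (idealModule s₀) (idealModule s₁)) ⊤ u = σ := by
  classical
  haveI : IsLocallyNoetherian C := LocallyOfFiniteType.isLocallyNoetherian f
  haveI : CompactSpace C := QuasiCompact.compactSpace_of_compactSpace f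
  haveI : C.IsSeparated := isSeparated_of_isSeparated_toSpec f
  haveI : Nontrivial k := inferInstance
  have hP1 : ∃ (k' : Type) (_ : Field k'), Nonempty (Ck ≅ ProjCech.PP k' 1) := ⟨k', inferInstance, ⟨e⟩⟩
  -- a uniformiser `ϖ`: `ker θ = 𝔪 = (ϖ)`, `ϖ` regular
  obtain ⟨ϖ, hϖirr⟩ := IsDiscreteValuationRing.exists_irreducible O
  have hmax : maximalIdeal O = Ideal.span {ϖ} := (IsDiscreteValuationRing.irreducible_iff_uniformizer ϖ).mp hϖirr
  have hker : RingHom.ker θ = maximalIdeal O := IsLocalRing.eq_maximalIdeal (RingHom.ker_isMaximal_of_surjective θ hθ)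
  have hϖ : ϖ ∈ RingHom.ker θ := by rw [hker, hmax]; exact Ideal.mem_span_singleton_self ϖ
  have hkerle : RingHom.ker θ ≤ Ideal.span {ϖ} := by rw [hker, hmax]
  have hϖreg : IsRegular ϖ := IsRegular.of_ne_zero hϖirr.ne_zero
  -- `N` is a vector bundle
  have hI₀ : IsVectorBundle (idealModule s₀) := isVectorBundle_idealModule_of_section O k θ C f Ck i t hθ hreg hsq hP1 s₀ hs₀
  have hI₁ : IsVectorBundle (idealModule s₁) := isVectorBundle_idealModule_of_section O k θ C f Ck i t hθ hreg hsq hP1 s₁ hs₁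
  have hNvb : IsVectorBundle (sheafHom (idealModule s₀) (idealModule s₁)) :=
    (isFiniteLocallyFree_sheafHom' (isVectorBundle_iff_isFiniteLocallyFree.mp hI₀)
      (isVectorBundle_iff_isFiniteLocallyFree.mp hI₁)).isVectorBundle
  -- the cover of `C` by all affine opens
  let U : C.affineOpens → C.Opens := fun V => (V : C.Opens)
  have hU : ∀ a, IsAffineOpen (U a) := fun V => V.2
  have hUU : ∀ a b, IsAffineOpen (U a ⊓ U b) := fun a b => (hU a).inf (hU b)
  have hcov : ⨆ a, U a = ⊤ := iSup_affineOpens_eq_top C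
  -- `ϖ`-torsion-free sections
  have htf : ∀ (a b l : C.affineOpens) (m : MSections f (sheafHom (idealModule s₀) (idealModule s₁)) (U a ⊓ U b ⊓ U l)),
      ϖ • m = 0 → m = 0 :=
    fun a b l m => smul_eq_zero_iff_of_flat_vectorBundle f _ hNvb ϖ hϖreg _ m
  -- `Ȟ¹` of `i^*N ≅ 𝒪_{Ck}` vanishes on the (affine) preimage cover
  haveI : IsClosedImmersion i := P1VB.isClosedImmersion_of_isPullback θ f hθ hsq
  have hV : ∀ a, IsAffineOpen (i ⁻¹ᵁ U a) := fun a => (hU a).preimage i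
  have hVcov : ⨆ a, i ⁻¹ᵁ U a = ⊤ := by rw [← Scheme.Hom.preimage_iSup, hcov]; rfl
  have h1 : Subsingleton (CechMH1 t ((Scheme.Modules.pullback i).obj (sheafHom (idealModule s₀) (idealModule s₁)))
      (fun a => i ⁻¹ᵁ U a)) :=
    subsingleton_cechMH1_of_iso t (fun a => i ⁻¹ᵁ U a) hN.some
      (subsingleton_cechMH1_unit_of_iso_PP' e t (fun a => i ⁻¹ᵁ U a) hV hVcov)
  -- brick E
  exact P1VB.exists_unitSection_eq_of_ker_le_span f U θ _ hθ ϖ hϖ hkerle hsq hNvb hU hUU hcov htf h1 σ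

end Summit.ResolutionOfSingularities.ResolutionOfSingularities.Cruxes.EquisingularLiftNat.F102

end
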